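import Literature.NumberTheory.EllipticCurves.CongruenceNumberLevelBound
import Literature.NumberTheory.EllipticCurves.PastenValuationProductThm75Proofs
import HarnessLib

/-!
# Murty–Pasten 2013, Thm 7.1 (height clause) from Thm 4.3 — the printed §§5–7 chain over the tree
# (proofs)

Topic `Literature/NumberTheory/EllipticCurves`; companion PROOF file (theorems only, no new statement;
D-0026) of `CongruenceNumberLevelBound.lean` (M. R. Murty, H. Pasten, J. Number Theory 133 (2013),
[`MurtyPasten2013`]). It discharges the named fact `MurtyPasten.faltingsHeight_lt` (Thm 7.1:
`h_F(E) < 0.1 N log N + 11` for every `E/ℚ`, in the tree's normalisation of the Faltings height)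
MODULO three named facts:

* `ModularForms.nonempty_modularParametrizationData` — modularity with an integral Manin constant
  (Wiles, Taylor–Wiles, BCDT; Edixhoven) — MP §6: "By the modularity theorem … `c_E` is a non-zero
  integer" (Thm 6.1);
* `ModularForms.PastenShimura2024_minimalDegree_le_163_mul` — Mazur–Kenku (MP §6: "there is an
  isogeny `ψ : E_f → E` defined over `ℚ` of degree at most `163`");
* `MurtyPasten.log_modularDegree_le` — MP Thm 4.3, the modular-degree clause (`log m_f ≤ (1/5) N log N`).

The remaining steps of the printed proof are THEOREMS of the tree: Zagier's identity
`4π² c² (f,f) = deg φ · covol(Λ)` (MP Prop. 6.2, there with a `log 2π` slip — see the ERRATUM in the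
statements file), the trivial Petersson bound `(f,f) ≥ e^{−4π}/(4π)` (MP: "`log ‖f‖ > −7.549`";
`IsNewformOf.peterssonProduct_re_ge`), combined as `Pasten2024.twelve_mul_neronLatticeHeight_le`
(`12 h ≤ 6 log deg − 6 log(4π² c₀)`, `log(4π² c₀) = log π − 4π`), the passage to a global minimal
model (`hasGlobalMinimalModel_rat_holds`, `faltingsHeight_smul`, `conductorNorm_smul_rat`) and
`Pasten2024.log_minModularDegree_le_of_class_bound` (minimal degree of the model
`≤ 163 · m_f`). Resulting constant: `h(E) ≤ ½(log 163 + N log N/5) + 2π − ½ log π < 0.1 N log N + 11`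
(numerically `+ 8.26`; the proof below uses the generous `log 163 ≤ 8 log 2`, `π ≤ 4`).

## References

* [MurtyPasten2013] M. R. Murty, H. Pasten, J. Number Theory 133 (2013): Thm 4.3, Thm 5.4, Thm 6.1,
  Props. 6.2–6.3, Thm 7.1 and its proof (pp. 3747–3752).
* [PastenShimura2024] H. Pasten, J. Number Theory 254 (2024) = arXiv:1705.09251, §3 (3.1)–(3.2).
-/

noncomputable section

open WeierstrassCurve

namespace Literature.NumberTheory.EllipticCurves

open ModularForms Pasten2024 ModularForm CongruenceSubgroup
open scoped MatrixGroups

/-- **Murty–Pasten 2013, Thm 7.1 (height clause), PROVED modulo modularity, Mazur–Kenku and Thm 4.3**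
(the printed proof, p. 3752: "Using Proposition 6.3 and Theorem 4.3, we get
`h_F(E) < ½ log m_f + 10.096 ≤ (1/10) N log N + 10.096`", run in the tree's normalisation of the
Faltings height, where the constant comes out as `½ log 163 + 2π − ½ log π + 1/200 < 11`).
[cite: MurtyPasten2013, Thm 7.1 (proof, p. 3752) with Prop. 6.3 and Thm 4.3] -/
theorem MurtyPasten.faltingsHeight_lt_of_modularity_of_log_modularDegree_le
    (hmod : nonempty_modularParametrizationData)
    (h163 : PastenShimura2024_minimalDegree_le_163_mul)
    (h43 : MurtyPasten.log_modularDegree_le) : MurtyPasten.faltingsHeight_lt := by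
  intro W _
  -- pass to a global minimal model `C • W`
  obtain ⟨C, hC⟩ := hasGlobalMinimalModel_rat_holds W
  haveI := hC
  have hN : (C • W).conductorNorm ℤ = W.conductorNorm ℤ := conductorNorm_smul_rat W C
  haveI : NeZero ((C • W).conductorNorm ℤ) := ⟨(conductorNorm_pos_holds (C • W)).ne'⟩
  rw [← faltingsHeight_smul W C, ← hN]
  set N : ℕ := (C • W).conductorNorm ℤ with hNdef
  have hN1 : (1 : ℝ) ≤ (N : ℝ) := by exact_mod_cast conductorNorm_pos_holds (C • W)
  have hNlogN : 0 ≤ (N : ℝ) * Real.log N := mul_nonneg (by linarith) (Real.log_nonneg hN1)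
  -- a datum of minimal degree for the minimal model, and the class bound from Thm 4.3
  obtain ⟨D, hDmin⟩ := exists_modularDegree_eq_minModularDegree (hmod (C • W))
  have hDmin' : D.deg = minModularDegree (C • W) N := hDmin
  have hclass := log_minModularDegree_le_of_class_bound h163 (hmod (C • W))
    (B := (1 / 5 : ℝ) * N * Real.log N + 1 / 100)
    (fun W₀ _ D₀ hmin => by have := h43 W₀ N D₀ hmin; linarith)
  -- `12 h ≤ 6 log deg − 6 log(4π² c₀)` with the trivial Petersson constant
  have hc₀ : (0 : ℝ) < Real.exp (-(4 * Real.pi)) / (4 * Real.pi) := by positivity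
  have hh := twelve_mul_neronLatticeHeight_le D hc₀ D.isNewformOf.peterssonProduct_re_ge
  rw [log_four_pi_sq_mul_trivialPeterssonConst] at hh
  have hheight : (C • W).faltingsHeight = neronLatticeHeight D.L := by
    rw [D.faltingsHeight_eq, neronLatticeHeight]
  -- numerics: `log 163 ≤ 8 log 2 < 5.55`, `0 ≤ log π`, `π ≤ 4`
  have hdeg : Real.log (D.deg : ℝ) ≤ Real.log 163 + ((1 / 5 : ℝ) * N * Real.log N + 1 / 100) := by
    rw [hDmin']; exact hclass
  have h163 : Real.log 163 ≤ 8 * Real.log 2 := by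
    rw [← Real.log_rpow (by norm_num), show ((2 : ℝ) ^ (8 : ℝ)) = 256 by norm_num]
    exact Real.log_le_log (by norm_num) (by norm_num)
  have hl2 := Real.log_two_lt_d9
  have hlogpi : 0 ≤ Real.log Real.pi := Real.log_nonneg (by linarith [Real.pi_gt_three])
  have hpi := Real.pi_le_four
  rw [hheight]
  linarith

end Literature.NumberTheory.EllipticCurves

end
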